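import Literature.Probability.Percolation.SharpnessDCTProofs
import HarnessLib

/-! # Box-path toolkit for the local modification on `ℤ²×ℤ` (line `locmod`, crux `CriticalCurveRegular`) -/

noncomputable section

open Set
open Literature.Probability.Percolation Literature.Probability.LatticeModels

namespace Summit.CriticalPhenomena.PercolationContinuityZ3.Cruxes.CriticalCurveRegular.Locmod
namespace BoxPaths

/-! ### §1 Lattice bookkeeping on `ℤ³` -/

/-- `y ≠ y + eᵢ`. -/
theorem self_ne_add_single (y : Site 3) (i : Fin 3) : y ≠ y + Pi.single i 1 := by
  intro h
  have := congr_fun h i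
  simp at this

/-- An edge of `ω` of the form `{y, y + eᵢ}` is an edge of the open graph of `ω`. -/
theorem openGraph_adj_of_mem {ω : Set (Sym2 (Site 3))} {y : Site 3} {i : Fin 3}
    (h : s(y, y + Pi.single i 1) ∈ ω) : (openGraph ω).Adj y (y + Pi.single i 1) :=
  (openGraph_adj _ _ _).2 ⟨h, self_ne_add_single y i⟩

/-- Every edge of `ℤ³` is `{y, y + eᵢ}` for some site `y` and direction `i`. -/
theorem exists_eq_mk_single_of_mem_edgeSet {e : Sym2 (Site 3)} (he : e ∈ (zdGraph 3).edgeSet) :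
    ∃ y : Site 3, ∃ i : Fin 3, e = s(y, y + Pi.single i 1) := by
  induction e using Sym2.ind with
  | _ a b =>
    rw [SimpleGraph.mem_edgeSet, zdGraph_adj_iff] at he
    obtain ⟨i, h | h⟩ := he
    · exact ⟨a, i, by rw [h]⟩
    · exact ⟨b, i, by rw [h, Sym2.eq_swap]⟩

/-- Two bonds `{x, x + eᵢ}` and `{x', x' + eⱼ}` coincide iff `x = x'` and `i = j`. -/
theorem mk_single_eq_mk_single_iff {x x' : Site 3} {i j : Fin 3} :
    s(x, x + Pi.single i 1) = s(x', x' + Pi.single j 1) ↔ x = x' ∧ i = j := by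
  constructor
  · intro h
    rw [Sym2.eq_iff] at h
    rcases h with ⟨rfl, h⟩ | ⟨h₁, h₂⟩
    · refine ⟨rfl, ?_⟩
      by_contra hij
      have := congr_fun h i
      simp [Pi.single_eq_of_ne hij] at this
    · exfalso
      have h₂i := congr_fun h₂ i
      have h₁i := congr_fun h₁ i
      rcases eq_or_ne i j with rfl | hij
      · simp at h₂i h₁i
        omega
      · simp [Pi.single_eq_of_ne hij] at h₂i h₁i
        omega
  · rintro ⟨rfl, rfl⟩
    rfl

/-- Two vertical bonds `{x, x + e₂}` and `{x', x' + e₂}` coincide only if `x = x'`. -/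
theorem eq_of_mk_vert_eq {x x' : Site 3}
    (h : s(x, x + Pi.single (2 : Fin 3) 1) = s(x', x' + Pi.single (2 : Fin 3) 1)) : x = x' :=
  (mk_single_eq_mk_single_iff.1 h).1

/-- Every site of `ℤ³` has at most (in fact exactly) `6` neighbours. -/
theorem card_neighborFinset_le (x : Site 3) : ((zdGraph 3).neighborFinset x).card ≤ 6 :=
  (card_neighborFinset_zdGraph_holds (d := 3) x).le

/-- At most `6 |Λ|` edges of `ℤ³` touch a finite set `Λ`. -/
theorem card_edgesTouching_le (Λ : Finset (Site 3)) :
    (edgesTouching (zdGraph 3) Λ).card ≤ 6 * Λ.card := by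
  calc (edgesTouching (zdGraph 3) Λ).card
      ≤ ∑ x ∈ Λ, ((zdGraph 3).incidenceFinset x).card := Finset.card_biUnion_le
    _ ≤ Λ.card • 6 := Finset.sum_le_card_nsmul _ _ _ fun x _ => by
        rw [SimpleGraph.card_incidenceFinset_eq_degree,
          ← SimpleGraph.card_neighborFinset_eq_degree]
        exact card_neighborFinset_le x
    _ = 6 * Λ.card := by rw [smul_eq_mul, mul_comm]

/-- Membership in the cube `x + [-r, r]³` in coordinates. -/
theorem mem_Icc_iff_coords {x y : Site 3} {r : ℕ} :
    y ∈ Finset.Icc (x - (r : Site 3)) (x + (r : Site 3)) ↔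
      ∀ i, x i - r ≤ y i ∧ y i ≤ x i + r := by
  simp only [Finset.mem_Icc, Pi.le_def, Pi.sub_apply, Pi.add_apply, Pi.natCast_apply]
  exact forall_and.symm

/-- Membership in the cube `x + [-2, 2]³` in coordinates. -/
theorem mem_Icc_two_iff {x y : Site 3} :
    y ∈ Finset.Icc (x - 2) (x + 2) ↔ ∀ i, x i - 2 ≤ y i ∧ y i ≤ x i + 2 := by
  simp only [Finset.mem_Icc, Pi.le_def, Pi.sub_apply, Pi.add_apply, Pi.ofNat_apply]
  exact forall_and.symm

/-- The cube `x + [-2, 2]³` has `125` sites. -/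
theorem card_Icc_two (x : Site 3) : (Finset.Icc (x - 2) (x + 2)).card = 125 := by
  rw [Pi.card_Icc]
  have h : ∀ i, (Finset.Icc ((x - 2) i) ((x + 2) i)).card = 5 := fun i => by
    rw [Int.card_Icc]
    simp only [Pi.sub_apply, Pi.add_apply, Pi.ofNat_apply]
    omega
  simp only [h, Finset.prod_const, Finset.card_univ, Fintype.card_fin]
  norm_num

/-- For `n ≥ 1` the origin is not on the inner boundary of `Λ_n`. -/
theorem zero_not_mem_innerBoundary_box {n : ℕ} (hn : 1 ≤ n) :
    (0 : Site 3) ∉ innerBoundary (zdGraph 3) (box 3 n) := by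
  intro h
  obtain ⟨i, hi⟩ := DCT16.exists_natAbs_eq_of_mem_innerBoundary_box h
  simp at hi
  omega

/-- The inner boundary of `Λ_n` consists of the sites of `Λ_n` with a coordinate of
modulus `n`. -/
theorem mem_innerBoundary_box_iff {n : ℕ} {y : Site 3} :
    y ∈ innerBoundary (zdGraph 3) (box 3 n) ↔ y ∈ box 3 n ∧ ∃ i, (y i).natAbs = n :=
  ⟨fun h => ⟨(mem_innerBoundary_iff.1 h).1, DCT16.exists_natAbs_eq_of_mem_innerBoundary_box h⟩,
    fun ⟨hy, _, hi⟩ => DCT16.mem_innerBoundary_box_of_natAbs_eq hy hi⟩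

/-- The box `Λ_n` is the coordinate box with bounds `lo = -n`, `hi = n` (bridge to §2–§3). -/
theorem coe_box_eq_coordBox (n : ℕ) :
    (↑(box 3 n) : Set (Site 3)) =
      {z : Site 3 | ∀ j, (-(n : Site 3)) j ≤ z j ∧ z j ≤ (n : Site 3) j} := by
  ext z
  simp [mem_box]

/-- Pointwise form of `coe_box_eq_coordBox`. -/
theorem coordBox_natCast_iff {n : ℕ} {z : Site 3} :
    (∀ j, (-(n : Site 3)) j ≤ z j ∧ z j ≤ (n : Site 3) j) ↔ z ∈ box 3 n := by
  simp [mem_box]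

/-! ### §2 Straight segments inside a coordinate box -/

/-- The `i`-th coordinate of `y + c eᵢ` is `y i + c`. -/
theorem add_single_apply_same (y : Site 3) (i : Fin 3) (c : ℤ) :
    (y + Pi.single i c : Site 3) i = y i + c := by
  simp

/-- The other coordinates of `y + c eᵢ` are those of `y`. -/
theorem add_single_apply_of_ne (y : Site 3) {i j : Fin 3} (h : j ≠ i) (c : ℤ) :
    (y + Pi.single i c : Site 3) j = y j := by
  simp [h]

/-- `y + c eᵢ` stays in the coordinate box `[lo, hi]` if `y` does and
`y i + c ∈ [lo i, hi i]`. -/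
theorem add_single_mem_coordBox {lo hi y : Site 3} {i : Fin 3} {c : ℤ}
    (hy : ∀ j, lo j ≤ y j ∧ y j ≤ hi j) (hc : lo i ≤ y i + c ∧ y i + c ≤ hi i) :
    ∀ j, lo j ≤ (y + Pi.single i c : Site 3) j ∧ (y + Pi.single i c : Site 3) j ≤ hi j := by
  intro j
  rcases eq_or_ne j i with rfl | h
  · rw [add_single_apply_same]; exact hc
  · rw [add_single_apply_of_ne y h]; exact hy j

/-- Upward straight segment `y → y + k eᵢ` (`k : ℕ`) in the open graph of `ω`, inside the
coordinate box `[lo, hi]`, provided the `k` bonds along the way lie in `ω`. -/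
theorem pathIn_segment_nat_up {ω : Set (Sym2 (Site 3))} (lo hi : Site 3) (y : Site 3)
    (i : Fin 3) (k : ℕ) (hy : ∀ j, lo j ≤ y j ∧ y j ≤ hi j) (hk : y i + k ≤ hi i)
    (hω : ∀ z : Site 3, (∀ j, lo j ≤ z j ∧ z j ≤ hi j) → (∀ j, j ≠ i → z j = y j) →
      y i ≤ z i → z i + 1 ≤ y i + k → s(z, z + Pi.single i 1) ∈ ω) :
    PathIn (openGraph ω) {z : Site 3 | ∀ j, lo j ≤ z j ∧ z j ≤ hi j} y
      (y + Pi.single i (k : ℤ)) := by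
  induction k with
  | zero =>
    rw [Nat.cast_zero, Pi.single_zero, add_zero]
    exact PathIn.refl hy
  | succ k ih =>
    have hk' : y i + k ≤ hi i := by omega
    have h₁ := ih hk' fun z hz hzj h1 h2 => hω z hz hzj h1 (by omega)
    have hz : ∀ j, lo j ≤ (y + Pi.single i (k : ℤ) : Site 3) j ∧
        (y + Pi.single i (k : ℤ) : Site 3) j ≤ hi j :=
      add_single_mem_coordBox hy ⟨by have := (hy i).1; omega, hk'⟩
    have hzj : ∀ j, j ≠ i → (y + Pi.single i (k : ℤ) : Site 3) j = y j := fun j hj =>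
      add_single_apply_of_ne y hj _
    have he : (y + Pi.single i (k : ℤ) + Pi.single i 1 : Site 3) =
        y + Pi.single i ((k + 1 : ℕ) : ℤ) := by
      rw [add_assoc, ← Pi.single_add, Nat.cast_succ]
    have hadj := openGraph_adj_of_mem (hω _ hz hzj (by rw [add_single_apply_same]; omega)
      (by rw [add_single_apply_same]; omega))
    rw [he] at hadj
    exact h₁.tail hadj (add_single_mem_coordBox hy ⟨by have := (hy i).1; omega, hk⟩)

/-- Downward straight segment `y → y - k eᵢ` (`k : ℕ`) in the open graph of `ω`, inside the
coordinate box `[lo, hi]`, provided the `k` bonds along the way lie in `ω`. -/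
theorem pathIn_segment_nat_down {ω : Set (Sym2 (Site 3))} (lo hi : Site 3) (y : Site 3)
    (i : Fin 3) (k : ℕ) (hy : ∀ j, lo j ≤ y j ∧ y j ≤ hi j) (hk : lo i ≤ y i - k)
    (hω : ∀ z : Site 3, (∀ j, lo j ≤ z j ∧ z j ≤ hi j) → (∀ j, j ≠ i → z j = y j) →
      y i - k ≤ z i → z i + 1 ≤ y i → s(z, z + Pi.single i 1) ∈ ω) :
    PathIn (openGraph ω) {z : Site 3 | ∀ j, lo j ≤ z j ∧ z j ≤ hi j} y
      (y + Pi.single i (-(k : ℤ))) := by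
  induction k with
  | zero =>
    rw [Nat.cast_zero, neg_zero, Pi.single_zero, add_zero]
    exact PathIn.refl hy
  | succ k ih =>
    have hk' : lo i ≤ y i - k := by omega
    have h₁ := ih hk' fun z hz hzj h1 h2 => hω z hz hzj (by omega) h2
    -- the new endpoint `w = y - (k+1) eᵢ` and the bond `{w, w + eᵢ}`
    have hw : ∀ j, lo j ≤ (y + Pi.single i (-((k + 1 : ℕ) : ℤ)) : Site 3) j ∧
        (y + Pi.single i (-((k + 1 : ℕ) : ℤ)) : Site 3) j ≤ hi j :=
      add_single_mem_coordBox hy ⟨by omega, by have := (hy i).2; omega⟩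
    have hwj : ∀ j, j ≠ i → (y + Pi.single i (-((k + 1 : ℕ) : ℤ)) : Site 3) j = y j :=
      fun j hj => add_single_apply_of_ne y hj _
    have he : (y + Pi.single i (-((k + 1 : ℕ) : ℤ)) + Pi.single i 1 : Site 3) =
        y + Pi.single i (-(k : ℤ)) := by
      rw [add_assoc, ← Pi.single_add, Nat.cast_succ, neg_add, neg_add_cancel_right]
    have hadj := openGraph_adj_of_mem (hω _ hw hwj (by rw [add_single_apply_same]; omega)
      (by rw [add_single_apply_same]; omega))
    rw [he] at hadj
    exact h₁.tail hadj.symm hw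

/-- Straight segment `y → y + m eᵢ` for `0 ≤ m` (no `min`/`max` in the bond hypothesis). -/
theorem pathIn_segment_of_nonneg {ω : Set (Sym2 (Site 3))} (lo hi : Site 3) (y : Site 3)
    (i : Fin 3) {m : ℤ} (hm0 : 0 ≤ m) (hy : ∀ j, lo j ≤ y j ∧ y j ≤ hi j) (hm : y i + m ≤ hi i)
    (hω : ∀ z : Site 3, (∀ j, lo j ≤ z j ∧ z j ≤ hi j) → (∀ j, j ≠ i → z j = y j) →
      y i ≤ z i → z i + 1 ≤ y i + m → s(z, z + Pi.single i 1) ∈ ω) :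
    PathIn (openGraph ω) {z : Site 3 | ∀ j, lo j ≤ z j ∧ z j ≤ hi j} y (y + Pi.single i m) := by
  obtain ⟨k, rfl⟩ := Int.eq_ofNat_of_zero_le hm0
  exact pathIn_segment_nat_up lo hi y i k hy hm hω

/-- Straight segment `y → y + m eᵢ` for `m ≤ 0` (no `min`/`max` in the bond hypothesis). -/
theorem pathIn_segment_of_nonpos {ω : Set (Sym2 (Site 3))} (lo hi : Site 3) (y : Site 3)
    (i : Fin 3) {m : ℤ} (hm0 : m ≤ 0) (hy : ∀ j, lo j ≤ y j ∧ y j ≤ hi j) (hm : lo i ≤ y i + m)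
    (hω : ∀ z : Site 3, (∀ j, lo j ≤ z j ∧ z j ≤ hi j) → (∀ j, j ≠ i → z j = y j) →
      y i + m ≤ z i → z i + 1 ≤ y i → s(z, z + Pi.single i 1) ∈ ω) :
    PathIn (openGraph ω) {z : Site 3 | ∀ j, lo j ≤ z j ∧ z j ≤ hi j} y (y + Pi.single i m) := by
  obtain ⟨k, rfl⟩ := Int.exists_eq_neg_ofNat hm0
  refine pathIn_segment_nat_down lo hi y i k hy (by rw [sub_eq_add_neg]; exact hm)
    fun z hz hzj h1 h2 => hω z hz hzj ?_ h2
  rwa [← sub_eq_add_neg]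

/-- **Straight segment.** `y → y + m eᵢ` (`m : ℤ`) in the open graph of `ω`, inside the
coordinate box `B(lo, hi) = {z | ∀ j, lo j ≤ z j ≤ hi j}`, provided `y ∈ B`, the endpoint's
`i`-th coordinate stays in `[lo i, hi i]`, and every bond `{z, z + eᵢ}` of the segment lies
in `ω`.

Usage note: when `y` is a composite expression (e.g. `a + Pi.single 2 c + Pi.single 0 d`),
either name the point first (`obtain ⟨p, hp⟩ : ∃ p, p = … := ⟨_, rfl⟩`, as in
`pathIn_column_then_L`) or write the `hω` closure in tactic mode (`fun z hz hzj h1 h2 => by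
exact …`); a term-mode `h2.trans …` against the un-instantiated binder type can be very slow
to elaborate. -/
theorem pathIn_segment {ω : Set (Sym2 (Site 3))} (lo hi : Site 3) (y : Site 3) (i : Fin 3)
    (m : ℤ) (hy : ∀ j, lo j ≤ y j ∧ y j ≤ hi j) (hm : lo i ≤ y i + m ∧ y i + m ≤ hi i)
    (hω : ∀ z : Site 3, (∀ j, lo j ≤ z j ∧ z j ≤ hi j) → (∀ j, j ≠ i → z j = y j) →
      min (y i) (y i + m) ≤ z i → z i + 1 ≤ max (y i) (y i + m) →
        s(z, z + Pi.single i 1) ∈ ω) :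
    PathIn (openGraph ω) {z : Site 3 | ∀ j, lo j ≤ z j ∧ z j ≤ hi j} y (y + Pi.single i m) := by
  rcases le_total 0 m with hm0 | hm0
  · exact pathIn_segment_of_nonneg lo hi y i hm0 hy hm.2 fun z hz hzj h1 h2 =>
      hω z hz hzj ((min_le_left _ _).trans h1) (h2.trans (le_max_right _ _))
  · exact pathIn_segment_of_nonpos lo hi y i hm0 hy hm.1 fun z hz hzj h1 h2 =>
      hω z hz hzj ((min_le_right _ _).trans h1) (h2.trans (le_max_left _ _))

/-! ### §3 Column-then-L paths inside a coordinate box -/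

/-- **Column, then an L.** Inside the coordinate box `B(lo, hi)`, if every vertical bond of the
column of `a` inside the box lies in `ωV` and every horizontal bond inside the box lies in `ωH`,
then `a` is joined to any `b ∈ B` in the open graph of `ωV ∪ ωH`: go vertically from `a` to
`p₁ = (a 0, a 1, b 2)`, then along `e₀` to `p₂ = (b 0, a 1, b 2)`, then along `e₁` to `b`. -/
theorem pathIn_column_then_L {ωV ωH : Set (Sym2 (Site 3))} (lo hi : Site 3) (a b : Site 3)
    (ha : ∀ j, lo j ≤ a j ∧ a j ≤ hi j) (hb : ∀ j, lo j ≤ b j ∧ b j ≤ hi j)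
    (hV : ∀ z : Site 3, (∀ j, lo j ≤ z j ∧ z j ≤ hi j) →
      lo 2 ≤ z 2 + 1 ∧ z 2 + 1 ≤ hi 2 → z 0 = a 0 → z 1 = a 1 → s(z, z + Pi.single 2 1) ∈ ωV)
    (hH : ∀ z : Site 3, ∀ i : Fin 3, i ≠ 2 → (∀ j, lo j ≤ z j ∧ z j ≤ hi j) →
      (lo i ≤ z i + 1 ∧ z i + 1 ≤ hi i) → s(z, z + Pi.single i 1) ∈ ωH) :
    PathIn (openGraph (ωV ∪ ωH)) {z : Site 3 | ∀ j, lo j ≤ z j ∧ z j ≤ hi j} a b := by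
  -- the two corners `p₁ = (a 0, a 1, b 2)` and `p₂ = (b 0, a 1, b 2)`, kept opaque
  obtain ⟨p₁, hp₁⟩ : ∃ p₁ : Site 3, p₁ = a + Pi.single 2 (b 2 - a 2) := ⟨_, rfl⟩
  obtain ⟨p₂, hp₂⟩ : ∃ p₂ : Site 3, p₂ = p₁ + Pi.single 0 (b 0 - a 0) := ⟨_, rfl⟩
  have hp₁0 : p₁ 0 = a 0 := by rw [hp₁]; exact add_single_apply_of_ne a (by decide) _
  have hp₁1 : p₁ 1 = a 1 := by rw [hp₁]; exact add_single_apply_of_ne a (by decide) _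
  have hp₂1 : p₂ 1 = a 1 := by
    rw [hp₂, ← hp₁1]; exact add_single_apply_of_ne p₁ (by decide) _
  -- leg 1: the column of `a`, from `a` to `p₁`
  have hm₁ : lo 2 ≤ a 2 + (b 2 - a 2) ∧ a 2 + (b 2 - a 2) ≤ hi 2 := by
    have := hb 2; constructor <;> omega
  have leg₁ := pathIn_segment (ω := ωV ∪ ωH) lo hi a 2 (b 2 - a 2) ha hm₁
    fun z hz hzj _ h2 => Set.mem_union_left _ (hV z hz
      ⟨by have := (hz 2).1; omega, h2.trans (max_le (ha 2).2 hm₁.2)⟩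
      (hzj 0 (by decide)) (hzj 1 (by decide)))
  rw [← hp₁] at leg₁
  have hp₁B : ∀ j, lo j ≤ p₁ j ∧ p₁ j ≤ hi j := leg₁.right_mem
  -- leg 2: along `e₀`, from `p₁` to `p₂`
  have hm₂ : lo 0 ≤ p₁ 0 + (b 0 - a 0) ∧ p₁ 0 + (b 0 - a 0) ≤ hi 0 := by
    have := hb 0; rw [hp₁0]; constructor <;> omega
  have leg₂ := pathIn_segment (ω := ωV ∪ ωH) lo hi p₁ 0 (b 0 - a 0) hp₁B hm₂
    fun z hz _ _ h2 => Set.mem_union_right _ (hH z 0 (by decide) hz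
      ⟨by have := (hz 0).1; omega, h2.trans (max_le (hp₁B 0).2 hm₂.2)⟩)
  rw [← hp₂] at leg₂
  have hp₂B : ∀ j, lo j ≤ p₂ j ∧ p₂ j ≤ hi j := leg₂.right_mem
  -- leg 3: along `e₁`, from `p₂` to `b = p₂ + (b 1 - a 1) e₁`
  have hm₃ : lo 1 ≤ p₂ 1 + (b 1 - a 1) ∧ p₂ 1 + (b 1 - a 1) ≤ hi 1 := by
    have := hb 1; rw [hp₂1]; constructor <;> omega
  have leg₃ := pathIn_segment (ω := ωV ∪ ωH) lo hi p₂ 1 (b 1 - a 1) hp₂B hm₃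
    fun z hz _ _ h2 => Set.mem_union_right _ (hH z 1 (by decide) hz
      ⟨by have := (hz 1).1; omega, h2.trans (max_le (hp₂B 1).2 hm₃.2)⟩)
  have hend : p₂ + Pi.single 1 (b 1 - a 1) = b := by
    rw [hp₂, hp₁]
    ext j
    fin_cases j <;> simp
  rw [hend] at leg₃
  exact (leg₁.trans leg₂).trans leg₃

end BoxPaths

/-! ## Registered export -/

/-- **Column-then-L path (registered helper signature of this file; = `BoxPaths.pathIn_column_then_L`
with explicit binders).** -/
theorem locMod_boxpaths_main :
    ∀ (ωV ωH : Set (Sym2 (Site 3))) (lo hi a b : Site 3),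
      (∀ j, lo j ≤ a j ∧ a j ≤ hi j) → (∀ j, lo j ≤ b j ∧ b j ≤ hi j) →
      (∀ z : Site 3, (∀ j, lo j ≤ z j ∧ z j ≤ hi j) →
        lo 2 ≤ z 2 + 1 ∧ z 2 + 1 ≤ hi 2 → z 0 = a 0 → z 1 = a 1 → s(z, z + Pi.single 2 1) ∈ ωV) →
      (∀ z : Site 3, ∀ i : Fin 3, i ≠ 2 → (∀ j, lo j ≤ z j ∧ z j ≤ hi j) →
        (lo i ≤ z i + 1 ∧ z i + 1 ≤ hi i) → s(z, z + Pi.single i 1) ∈ ωH) →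
      PathIn (openGraph (ωV ∪ ωH)) {z : Site 3 | ∀ j, lo j ≤ z j ∧ z j ≤ hi j} a b :=
  fun _ _ lo hi a b ha hb hV hH => BoxPaths.pathIn_column_then_L lo hi a b ha hb hV hH

end Summit.CriticalPhenomena.PercolationContinuityZ3.Cruxes.CriticalCurveRegular.Locmod
end
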